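import Summits.NavierStokesRegularity.FluidComputer.TubeTablePost13
import HarnessLib

/-!
# Kernel run of the post-ramp box tube, chunks 30 … 34 (bp3 gen 16)

HONEST FRAMING: low prior, high value-of-information experiment on Tao's machine paradigm; NOT a
claim that NS blows up.

Kernel evaluations (`decide +kernel`; no `native_decide`, no extra axioms) of the in-tree tube checker
`runTube` (`P = 60`, 12 Taylor terms, cube `Rt`, read-out `CLt`) on the chunks `cP13 30 … cP13 34`
(= design chunks `cT 43 … cT 47`) of `TubeTablePost13.lean`, each from the recorded boundary
state `sP13 i` to `sP13 (i+1)`.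

[cite: Tao2016AveragedNS, §5.5 Thm 5.3 (5.5)]
-/

namespace Summit.NavierStokesRegularity.FluidComputer

namespace TubeTablePost13

open Literature.Analysis.FluidPDE.FluidComputer Literature.Analysis.FluidPDE.FluidComputer.TubeTable
open Literature.Analysis.FluidPDE.FluidComputer.ThresholdLevelTable (GIt)

set_option maxHeartbeats 10000000 in
set_option maxRecDepth 200000 in
/-- Chunk 30 of the post-ramp tube run (design chunk 43: 20 steps at `h = 2^-11`). [folklore] -/
theorem runP13_30 : runTube 60 12 GIt CLt Rt (sP13 30) (cP13 30) = some (sP13 (30 + 1)) := by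
  decide +kernel

set_option maxHeartbeats 10000000 in
set_option maxRecDepth 200000 in
/-- Chunk 31 of the post-ramp tube run (design chunk 44: 50 steps at `h = 2^-13`). [folklore] -/
theorem runP13_31 : runTube 60 12 GIt CLt Rt (sP13 31) (cP13 31) = some (sP13 (31 + 1)) := by
  decide +kernel

set_option maxHeartbeats 10000000 in
set_option maxRecDepth 200000 in
/-- Chunk 32 of the post-ramp tube run (design chunk 45: 50 steps at `h = 2^-13`). [folklore] -/
theorem runP13_32 : runTube 60 12 GIt CLt Rt (sP13 32) (cP13 32) = some (sP13 (32 + 1)) := by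
  decide +kernel

set_option maxHeartbeats 10000000 in
set_option maxRecDepth 200000 in
/-- Chunk 33 of the post-ramp tube run (design chunk 46: 50 steps at `h = 2^-13`). [folklore] -/
theorem runP13_33 : runTube 60 12 GIt CLt Rt (sP13 33) (cP13 33) = some (sP13 (33 + 1)) := by
  decide +kernel

set_option maxHeartbeats 10000000 in
set_option maxRecDepth 200000 in
/-- Chunk 34 of the post-ramp tube run (design chunk 47: 33 steps at `h = 2^-13`). [folklore] -/
theorem runP13_34 : runTube 60 12 GIt CLt Rt (sP13 34) (cP13 34) = some (sP13 (34 + 1)) := by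
  decide +kernel

end TubeTablePost13

end Summit.NavierStokesRegularity.FluidComputer
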